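import Mathlib
import Summits.Ventures.HodgeRepro.Tier4.Line1.RTFSetting
import Summits.Ventures.HodgeRepro.Tier4.Line1.RtfUnfold
import Summits.Ventures.HodgeRepro.Tier4.Line1.RtfSpectralStep
import Summits.Ventures.HodgeRepro.Tier4.Line1.KernelSupportFinite
import Summits.Ventures.HodgeRepro.Tier4.Line1.KernelUnfold
import Summits.Ventures.HodgeRepro.Tier4.Line1.KernelOperator
import Summits.Ventures.HodgeRepro.Tier4.Line1.KernelOpEqR
import Summits.Ventures.HodgeRepro.Tier4.Line1.KernelEigen
import Summits.Ventures.HodgeRepro.Tier4.Line1.KernelCompact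
import Summits.Ventures.HodgeRepro.Tier4.Line1.InnerCalculus
import Summits.Ventures.HodgeRepro.Tier4.Line1.KernelAdjoint
import Summits.Ventures.HodgeRepro.Tier4.Line1.RelClosed
import Summits.Ventures.HodgeRepro.Tier4.Line1.RelClosedOrtho

/-!
# Tier4/Line1/IrreducibleMinimal — LINE L1, towards J1-(4b): the minimality argument R-E

Blind re-derivation cell `pub-hodge-repro`, Tier 4 «prove the step» (README §9–§10), seat t4-L1-p4 (prover, gen 0;
J1-(4b) `exists_irreducible_invariant_subspace` (Skeleton v0.16 L444, the declared wall) as census + rungs, S12549;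
after `InnerCalculus` and `KernelAdjoint`).  Generic Part I over every `RTF.Setting G`, `[SecondCountableTopology G]`
where the `L²(DG)` Hilbert-space arguments need it; Mathlib + the landed L1 layer only.  Paper: proofs/t4/L1/J1-4b.md.

This module (3 of 4): R-E `irreducible_of_minimal` — Deitmar–Echterhoff 9.2.7 rung (iv) (t4-lit-1 row 47, S12555):
a relatively closed invariant `U` whose trace on the finite-dimensional eigenspace `E` of `T_{f*} ∘ T_f` (eigenvalue
`μ ≠ 0`) is non-zero, of least dimension, and which lies in every relatively closed invariant subspace with the same
trace, is irreducible in the DEFINED sense of the skeleton (every invariant `V' ⊆ U` is pointwise zero or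
`L²(DG)`-dense in `U`): the relative closure `U₁` of `V'` and the complement `U₂ = U ∩ V'^⊥` split a non-zero vector of
`E ⊓ cls U` through the orthogonal projection (`starProjection_eigen`), and
`dim (E ⊓ cls U₁) + dim (E ⊓ cls U₂) ≤ dim (E ⊓ cls U)` contradicts minimality.

Nothing here says anything about the status of the Hodge conjecture for CM abelian varieties, which is NOT proved;
HC_CM is NOT proved by anyone in this repository.
-/

set_option autoImplicit false

noncomputable section

namespace Summit.Ventures.HodgeRepro.Tier4.Line1

open MeasureTheory Topology Filter Set
open scoped Uniformity Pointwise InnerProductSpace ComplexConjugate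

namespace RTF

variable {G : Type} [Group G] [TopologicalSpace G] [IsTopologicalGroup G] [MeasurableSpace G]
  [BorelSpace G]

namespace Setting

variable (S : Setting G)

/-- R-E (THE MINIMALITY ARGUMENT, Deitmar–Echterhoff 9.2.7 rung (iv)): a relatively closed invariant `U`
whose trace `E ⊓ cls U` on the finite-dimensional eigenspace `E` of `T = T_{f*} ∘ T_f` (eigenvalue `μ ≠ 0`)
is non-zero, of minimal dimension among all relatively closed invariant subspaces with non-zero trace, and
contained in every relatively closed invariant subspace with the same trace, is IRREDUCIBLE in the sense of
the skeleton: every invariant `V' ⊆ U` is pointwise zero or `L²(DG)`-dense in `U`.  (If not, the relative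
closure `U₁` of `V'` and its orthogonal complement `U₂` in `U` split a non-zero vector of `E ⊓ cls U` through
the orthogonal projection — `starProjection_eigen` keeps it in `E` —, and the dimension count
`dim (E ⊓ cls U₁) + dim (E ⊓ cls U₂) ≤ dim (E ⊓ cls U)` contradicts minimality.) -/
theorem irreducible_of_minimal [SecondCountableTopology G] {V : Set (G → ℂ)} {f : G → ℂ} (hf : IsTest f)
    {μ : ℂ} (hμ : μ ≠ 0)
    (T₁ T₂ : Lp ℂ 2 (S.μ.restrict S.DG) →L[ℂ] Lp ℂ 2 (S.μ.restrict S.DG))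
    (hT₁ : ∀ ψ : Lp ℂ 2 (S.μ.restrict S.DG), ⇑(T₁ ψ) =ᵐ[S.μ.restrict S.DG] S.kernelOp (cj (refl f)) ⇑ψ)
    (hT₂ : ∀ ψ : Lp ℂ 2 (S.μ.restrict S.DG), ⇑(T₂ ψ) =ᵐ[S.μ.restrict S.DG] S.kernelOp f ⇑ψ)
    {U : Set (G → ℂ)} (hU : S.RelClosed V U)
    (hne : Module.End.eigenspace ((T₁.comp T₂ : Lp ℂ 2 (S.μ.restrict S.DG) →L[ℂ]
      Lp ℂ 2 (S.μ.restrict S.DG)) : Lp ℂ 2 (S.μ.restrict S.DG) →ₗ[ℂ] Lp ℂ 2 (S.μ.restrict S.DG)) μ ⊓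
      S.cls hU ≠ ⊥)
    (hmin : ∀ (U' : Set (G → ℂ)) (hU' : S.RelClosed V U'),
      Module.End.eigenspace ((T₁.comp T₂ : Lp ℂ 2 (S.μ.restrict S.DG) →L[ℂ]
        Lp ℂ 2 (S.μ.restrict S.DG)) : Lp ℂ 2 (S.μ.restrict S.DG) →ₗ[ℂ] Lp ℂ 2 (S.μ.restrict S.DG)) μ ⊓
        S.cls hU' ≠ ⊥ →
      Module.finrank ℂ ((Module.End.eigenspace ((T₁.comp T₂ : Lp ℂ 2 (S.μ.restrict S.DG) →L[ℂ]
        Lp ℂ 2 (S.μ.restrict S.DG)) : Lp ℂ 2 (S.μ.restrict S.DG) →ₗ[ℂ] Lp ℂ 2 (S.μ.restrict S.DG)) μ ⊓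
        S.cls hU : Submodule ℂ (Lp ℂ 2 (S.μ.restrict S.DG)))) ≤
      Module.finrank ℂ ((Module.End.eigenspace ((T₁.comp T₂ : Lp ℂ 2 (S.μ.restrict S.DG) →L[ℂ]
        Lp ℂ 2 (S.μ.restrict S.DG)) : Lp ℂ 2 (S.μ.restrict S.DG) →ₗ[ℂ] Lp ℂ 2 (S.μ.restrict S.DG)) μ ⊓
        S.cls hU' : Submodule ℂ (Lp ℂ 2 (S.μ.restrict S.DG)))))
    (hint : ∀ (U' : Set (G → ℂ)) (hU' : S.RelClosed V U'),
      Module.End.eigenspace ((T₁.comp T₂ : Lp ℂ 2 (S.μ.restrict S.DG) →L[ℂ]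
        Lp ℂ 2 (S.μ.restrict S.DG)) : Lp ℂ 2 (S.μ.restrict S.DG) →ₗ[ℂ] Lp ℂ 2 (S.μ.restrict S.DG)) μ ⊓
        S.cls hU' =
      Module.End.eigenspace ((T₁.comp T₂ : Lp ℂ 2 (S.μ.restrict S.DG) →L[ℂ]
        Lp ℂ 2 (S.μ.restrict S.DG)) : Lp ℂ 2 (S.μ.restrict S.DG) →ₗ[ℂ] Lp ℂ 2 (S.μ.restrict S.DG)) μ ⊓
        S.cls hU → U ⊆ U') :
    S.IsIrreducible U := by
  haveI := S.haar
  haveI : Countable S.Gk := S.countable_Gk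
  haveI : IsFiniteMeasure (S.μ.restrict S.DG) := isFiniteMeasure_restrict.mpr S.measure_DG_ne_top
  set T := T₁.comp T₂ with hTdef
  set EH := Module.End.eigenspace (T : Lp ℂ 2 (S.μ.restrict S.DG) →ₗ[ℂ] Lp ℂ 2 (S.μ.restrict S.DG)) μ
    with hEH
  have hTc : IsCompactOperator T := S.kernelCLM_comp_isCompactOperator hf T₁ T₂ hT₂
  have hTs : (T : Lp ℂ 2 (S.μ.restrict S.DG) →ₗ[ℂ] Lp ℂ 2 (S.μ.restrict S.DG)).IsSymmetric :=
    S.kernelCLM_comp_isSymmetric hf T₁ T₂ hT₁ hT₂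
  haveI hEHfin : FiniteDimensional ℂ EH := ContinuousLinearMap.finite_dimensional_eigenspace hTc μ hμ
  intro V' hV' hV'U
  by_contra hcon
  rw [not_or] at hcon
  obtain ⟨hnz, hnd⟩ := hcon
  push Not at hnz hnd
  obtain ⟨φ₀, hφ₀V, x₀, hφ₀x⟩ := hnz
  obtain ⟨w, hwU, ε, hε, hwfar⟩ := hnd
  have hV'ne : V'.Nonempty := ⟨φ₀, hφ₀V⟩
  -- the closed subspace `K = cl (classes V')`
  set K := (S.classes V' hV' hV'ne).topologicalClosure with hK
  have hKc : IsClosed (K : Set (Lp ℂ 2 (S.μ.restrict S.DG))) := Submodule.isClosed_topologicalClosure _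
  have hKinv : ∀ v ∈ K, T v ∈ K := fun v hv =>
    S.kernelCLM_mapsTo_closure hV' hV'ne hf.refl.cj T₁ hT₁ _
      (S.kernelCLM_mapsTo_closure hV' hV'ne hf T₂ hT₂ v hv)
  haveI : CompleteSpace K := hKc.completeSpace_coe
  -- the two relatively closed invariant subspaces
  set U₁ : Set (G → ℂ) := {ψ | ψ ∈ U ∧ ∀ ε : ℝ, 0 < ε → ∃ ψ' ∈ V',
    eLpNorm (fun x => ψ x - ψ' x) 2 (S.μ.restrict S.DG) < ENNReal.ofReal ε} with hU₁def
  have hU₁ : S.RelClosed V U₁ := S.relClosed_closure hU hV' hV'ne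
  set U₂ : Set (G → ℂ) := {ψ | ψ ∈ U ∧ ∀ φ ∈ V', S.inner ψ φ = 0} with hU₂def
  have hU₂ : S.RelClosed V U₂ := S.relClosed_ortho hU hV'
  -- the classes of `U₁` lie in `K`, those of `U₂` in `Kᗮ`
  have hcls₁ : S.cls hU₁ ≤ K := by
    rintro u ⟨ψ, ⟨hψU, happ⟩, hu⟩
    have hψc := hU.inv.cont ψ hψU
    have e : u = (S.memLp_two_DG hψc).toLp ψ := by
      apply Lp.ext
      filter_upwards [hu, MemLp.coeFn_toLp (S.memLp_two_DG hψc)] with x h1 h2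
      rw [h1, h2]
    rw [e]
    exact (S.toLp_mem_closure_iff hV' hV'ne hψc).mpr happ
  have hcls₂ : S.cls hU₂ ≤ Kᗮ := by
    rintro u ⟨ψ, ⟨hψU, horth⟩, hu⟩
    have hψc := hU.inv.cont ψ hψU
    have e : u = (S.memLp_two_DG hψc).toLp ψ := by
      apply Lp.ext
      filter_upwards [hu, MemLp.coeFn_toLp (S.memLp_two_DG hψc)] with x h1 h2
      rw [h1, h2]
    rw [e, Submodule.mem_orthogonal]
    intro v hv
    have hcl : IsClosed {v : Lp ℂ 2 (S.μ.restrict S.DG) | ⟪v, (S.memLp_two_DG hψc).toLp ψ⟫_ℂ = 0} :=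
      isClosed_eq (continuous_id.inner continuous_const) continuous_const
    have hsub : (S.classes V' hV' hV'ne : Set (Lp ℂ 2 (S.μ.restrict S.DG))) ⊆
        {v | ⟪v, (S.memLp_two_DG hψc).toLp ψ⟫_ℂ = 0} := by
      rintro v' ⟨φ, hφ, hv'⟩
      have hφc := hV'.cont φ hφ
      have e' : v' = (S.memLp_two_DG hφc).toLp φ := by
        apply Lp.ext
        filter_upwards [hv', MemLp.coeFn_toLp (S.memLp_two_DG hφc)] with x h1 h2
        rw [h1, h2]
      show ⟪v', (S.memLp_two_DG hψc).toLp ψ⟫_ℂ = 0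
      rw [e', ← S.inner_eq_L2 hψc hφc]
      exact horth φ hφ
    have : (K : Set (Lp ℂ 2 (S.μ.restrict S.DG))) ⊆
        {v | ⟪v, (S.memLp_two_DG hψc).toLp ψ⟫_ℂ = 0} := by
      rw [hK, Submodule.topologicalClosure_coe]
      exact closure_minimal hsub hcl
    exact this hv
  -- a non-zero vector of `E ⊓ cls U` and its member of `U`
  obtain ⟨u, ⟨huE, huU⟩, hu0⟩ := (Submodule.ne_bot_iff _).mp hne
  obtain ⟨ψv, hψvU, huψ⟩ := huU
  have hψvc := hU.inv.cont ψv hψvU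
  have hψvinv := hU.inv.inv ψv hψvU
  have hTu : T u = μ • u := Module.End.mem_eigenspace_iff.mp huE
  -- the projection `u₁ = P u ∈ K` and its continuous invariant representative `ψ₁`
  set u₁ := K.starProjection u with hu₁
  have hu₁K : u₁ ∈ K := K.starProjection_apply_mem u
  have hTu₁ : T u₁ = μ • u₁ := starProjection_eigen hTs hKc hKinv hTu
  have hT₂u₁_int : Integrable (⇑(T₂ u₁)) (S.μ.restrict S.DG) :=
    (Lp.memLp (T₂ u₁)).integrable (by norm_num)
  set ψ₁ : G → ℂ := fun x => μ⁻¹ * S.kernelOp (cj (refl f)) (⇑(T₂ u₁)) x with hψ₁def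
  have hψ₁c : Continuous ψ₁ := continuous_const.mul (S.continuous_kernelOp hf.refl.cj hT₂u₁_int)
  have hψ₁inv : S.Invariant ψ₁ := fun γ x => by
    simp only [hψ₁def]
    rw [S.kernelOp_invariant (cj (refl f)) (⇑(T₂ u₁)) γ x]
  have hu₁ψ : ⇑u₁ =ᵐ[S.μ.restrict S.DG] ψ₁ := by
    have e : u₁ = μ⁻¹ • T u₁ := by rw [hTu₁, smul_smul, inv_mul_cancel₀ hμ, one_smul]
    have h1 : ⇑(T u₁) =ᵐ[S.μ.restrict S.DG] S.kernelOp (cj (refl f)) (⇑(T₂ u₁)) := hT₁ (T₂ u₁)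
    rw [e]
    filter_upwards [Lp.coeFn_smul μ⁻¹ (T u₁), h1] with x h2 h3
    rw [h2, Pi.smul_apply, smul_eq_mul, h3]
  have htoLpψ₁ : (S.memLp_two_DG hψ₁c).toLp ψ₁ = u₁ := by
    apply Lp.ext
    filter_upwards [MemLp.coeFn_toLp (S.memLp_two_DG hψ₁c), hu₁ψ] with x h1 h2
    rw [h1, h2]
  have happ₁ : ∀ ε : ℝ, 0 < ε → ∃ ψ' ∈ V',
      eLpNorm (fun x => ψ₁ x - ψ' x) 2 (S.μ.restrict S.DG) < ENNReal.ofReal ε := by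
    rw [← S.toLp_mem_closure_iff hV' hV'ne hψ₁c, htoLpψ₁]
    exact hu₁K
  have hψ₁U : ψ₁ ∈ U := by
    refine hU.closed ψ₁ hψ₁c hψ₁inv fun ε hε => ?_
    obtain ⟨ψ', hψ'V, hlt⟩ := happ₁ ε hε
    exact ⟨ψ', hV'U hψ'V, hlt⟩
  have hψ₁U₁ : ψ₁ ∈ U₁ := ⟨hψ₁U, happ₁⟩
  -- the complementary piece `ψ₂ = ψv − ψ₁ ∈ U₂`
  set ψ₂ : G → ℂ := fun x => ψv x - ψ₁ x with hψ₂def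
  have hψ₂c : Continuous ψ₂ := hψvc.sub hψ₁c
  have hψ₂U : ψ₂ ∈ U := by
    have h1 := hU.inv.add ψv hψvU (fun x => (-1 : ℂ) * ψ₁ x) (hU.inv.smul ψ₁ hψ₁U (-1))
    have e : (fun x => ψv x + (-1 : ℂ) * ψ₁ x) = ψ₂ := by ext x; simp [hψ₂def]; ring
    rw [e] at h1
    exact h1
  have htoLpψ₂ : (S.memLp_two_DG hψ₂c).toLp ψ₂ = u - u₁ := by
    apply Lp.ext
    filter_upwards [MemLp.coeFn_toLp (S.memLp_two_DG hψ₂c), Lp.coeFn_sub u u₁, huψ, hu₁ψ]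
      with x h1 h2 h3 h4
    rw [h1, h2, Pi.sub_apply, h3, h4]
  have hu_sub : u - u₁ ∈ Kᗮ := K.sub_starProjection_mem_orthogonal u
  have hψ₂U₂ : ψ₂ ∈ U₂ := by
    refine ⟨hψ₂U, fun φ hφ => ?_⟩
    have hφc := hV'.cont φ hφ
    rw [S.inner_eq_L2 hψ₂c hφc, htoLpψ₂]
    apply Submodule.inner_right_of_mem_orthogonal _ hu_sub
    exact Submodule.le_topologicalClosure _ ⟨φ, hφ, MemLp.coeFn_toLp _⟩
  have hu₁E : u₁ ∈ EH := Module.End.mem_eigenspace_iff.mpr hTu₁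
  have hu₂E : u - u₁ ∈ EH := EH.sub_mem huE hu₁E
  -- the dimension bookkeeping
  have hfin : ∀ (U' : Set (G → ℂ)) (hU' : S.RelClosed V U'),
      FiniteDimensional ℂ ((EH ⊓ S.cls hU' : Submodule ℂ (Lp ℂ 2 (S.μ.restrict S.DG)))) :=
    fun U' hU' => Submodule.finiteDimensional_of_le inf_le_left
  haveI := hfin U hU
  haveI := hfin U₁ hU₁
  haveI := hfin U₂ hU₂
  have hle₁ : EH ⊓ S.cls hU₁ ≤ EH ⊓ S.cls hU :=
    inf_le_inf_left _ (S.cls_mono hU₁ hU fun ψ hψ => hψ.1)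
  have hle₂ : EH ⊓ S.cls hU₂ ≤ EH ⊓ S.cls hU :=
    inf_le_inf_left _ (S.cls_mono hU₂ hU fun ψ hψ => hψ.1)
  -- the trichotomy
  by_cases hψ₁z : u₁ = 0
  · -- `ψ₁ = 0`: then `u = u − u₁ ∈ E ⊓ cls U₂`, so `U ⊆ U₂` and `V' ⊥ V'`
    have hu₂ : u ∈ EH ⊓ S.cls hU₂ := by
      have : u = u - u₁ := by rw [hψ₁z, sub_zero]
      rw [this]
      refine ⟨hu₂E, ?_⟩
      rw [← htoLpψ₂]
      exact S.toLp_mem_cls hU₂ hψ₂U₂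
    have hne₂ : EH ⊓ S.cls hU₂ ≠ ⊥ := (Submodule.ne_bot_iff _).mpr ⟨u, hu₂, hu0⟩
    have heq : EH ⊓ S.cls hU₂ = EH ⊓ S.cls hU :=
      Submodule.eq_of_le_of_finrank_eq hle₂ (le_antisymm (Submodule.finrank_mono hle₂) (hmin U₂ hU₂ hne₂))
    have hUU₂ : U ⊆ U₂ := hint U₂ hU₂ heq
    have hφ₀U₂ : φ₀ ∈ U₂ := hUU₂ (hV'U hφ₀V)
    have h0 := S.eq_zero_of_inner_self_eq_zero (hV'.inv φ₀ hφ₀V) (hV'.cont φ₀ hφ₀V) (hφ₀U₂.2 φ₀ hφ₀V)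
    exact hφ₀x (by rw [h0]; rfl)
  by_cases hψ₂z : u - u₁ = 0
  · -- `ψ₂ = 0`: then `u = u₁ ∈ E ⊓ cls U₁`, so `U ⊆ U₁` and `w` is approximable
    have hu₁' : u ∈ EH ⊓ S.cls hU₁ := by
      have : u = u₁ := sub_eq_zero.mp hψ₂z
      rw [this]
      refine ⟨hu₁E, ?_⟩
      rw [← htoLpψ₁]
      exact S.toLp_mem_cls hU₁ hψ₁U₁
    have hne₁ : EH ⊓ S.cls hU₁ ≠ ⊥ := (Submodule.ne_bot_iff _).mpr ⟨u, hu₁', hu0⟩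
    have heq : EH ⊓ S.cls hU₁ = EH ⊓ S.cls hU :=
      Submodule.eq_of_le_of_finrank_eq hle₁ (le_antisymm (Submodule.finrank_mono hle₁) (hmin U₁ hU₁ hne₁))
    have hUU₁ : U ⊆ U₁ := hint U₁ hU₁ heq
    obtain ⟨ψ', hψ'V, hlt⟩ := (hUU₁ hwU).2 ε hε
    exact absurd hlt (not_lt.mpr (hwfar ψ' hψ'V))
  · -- both non-zero: the dimension count contradicts minimality
    have hne₁ : EH ⊓ S.cls hU₁ ≠ ⊥ := by
      refine (Submodule.ne_bot_iff _).mpr ⟨u₁, ⟨hu₁E, ?_⟩, hψ₁z⟩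
      rw [← htoLpψ₁]
      exact S.toLp_mem_cls hU₁ hψ₁U₁
    have hne₂ : EH ⊓ S.cls hU₂ ≠ ⊥ := by
      refine (Submodule.ne_bot_iff _).mpr ⟨u - u₁, ⟨hu₂E, ?_⟩, hψ₂z⟩
      rw [← htoLpψ₂]
      exact S.toLp_mem_cls hU₂ hψ₂U₂
    have hinf : (EH ⊓ S.cls hU₁) ⊓ (EH ⊓ S.cls hU₂) = ⊥ := by
      rw [eq_bot_iff]
      intro v hv
      have h1 : v ∈ K := hcls₁ hv.1.2
      have h2 : v ∈ Kᗮ := hcls₂ hv.2.2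
      have : v ∈ K ⊓ Kᗮ := ⟨h1, h2⟩
      rw [Submodule.inf_orthogonal_eq_bot] at this
      exact this
    have hsup : (EH ⊓ S.cls hU₁) ⊔ (EH ⊓ S.cls hU₂) ≤ EH ⊓ S.cls hU := sup_le hle₁ hle₂
    have hdim := Submodule.finrank_sup_add_finrank_inf_eq (EH ⊓ S.cls hU₁) (EH ⊓ S.cls hU₂)
    rw [hinf, finrank_bot, add_zero] at hdim
    have h3 : Module.finrank ℂ ((EH ⊓ S.cls hU₁) ⊔ (EH ⊓ S.cls hU₂) : Submodule ℂ _) ≤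
        Module.finrank ℂ ((EH ⊓ S.cls hU : Submodule ℂ (Lp ℂ 2 (S.μ.restrict S.DG)))) :=
      Submodule.finrank_mono hsup
    have h4 : 0 < Module.finrank ℂ ((EH ⊓ S.cls hU₂ : Submodule ℂ (Lp ℂ 2 (S.μ.restrict S.DG)))) := by
      rw [Nat.pos_iff_ne_zero]
      intro h0
      exact hne₂ (Submodule.finrank_eq_zero.mp h0)
    have h5 := hmin U₁ hU₁ hne₁
    omega

end Setting

end RTF

end Summit.Ventures.HodgeRepro.Tier4.Line1
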